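import Summits.BirchSwinnertonDyer.BirchSwinnertonDyer.Theorems.ResidualThetaTransportAtTwoResidualSignedLambdaLowerCMAtTwoRhoLayerPairingCompat
import Literature.NumberTheory.EllipticCurves.GreenbergSelmerCofreeGaloisModule
import HarnessLib

/-!
# The SCALAR endomorphisms `a · : A_ρ[N] ⟶ A_ρ[N]` (`a ∈ 𝒪`) of the torsion coefficient modules, global and local — the coefficient morphisms
# through which the `𝒪`/`ℤ₂`-structures act on the layer cohomology `H¹(U_{n,w}, A_ρ[2^k]|)` (definitions)

Route `ResidualThetaTransportAtTwo` (RTT), crux RSL_g `ResidualSignedLambdaLowerCMAtTwo` (stmt-BirchSwinnertonDyer-22608), line «onepair» (v3d), GLUE-SPEC-g18 T2(b):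
the LEAD's `AwayPins` existence (E3) needs `hlocdS_smul` — `locd_S((C ι a) • x) = a • locd_S x` — i.e. the scalar `a` moved through `proj`, `conj`, `red_{2^k}`,
the layer pairing and `jAway`; every step is the functoriality of `H¹` along the coefficient morphism «multiplication by `a` on `A_ρ[N]`», which this file
NAMES (companion of `cofreeScalar` / `cofreeLocalScalar` on `A_ρ`, `GreenbergSelmerCofreeGaloisModule`, and of tp2-p2x's `cofreeTorsionIncl`, p705712).
Seat `prover-bsd-wall-tp2-p2x-w2` g20 (`--supports 22608 --as helper`, closes nothing). DEFINITIONS with bodies + unfolding lemmas only (no named fact,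
no instance, no notation, no `sorry`). BSD is not proved by any of this.

* `cofreeTorsionScalar S ρ N a : A_ρ[N] ⟶ A_ρ[N]` (`x ↦ a • x`, a morphism of the discrete `Γ_ℚ`-modules since `Γ_ℚ` acts `𝒪`-linearly),
  `coe_cofreeTorsionScalar_apply` (`rfl`), `cofreeTorsionInclusion_cofreeTorsionScalar` (`(A[N] ↪ A) ∘ (a·) = (a·) ∘ (A[N] ↪ A)`),
  `cofreeTorsionScalar_divPowCofreeMkTorsion` (`a · (p^{-k} t) = p^{-k}(a t)`: the scalar on `T_ρ/p^k`);
* `cofreeTorsionLocalScalar S ρ N a v` (restriction to `Γ_v`), `coe_cofreeTorsionLocalScalar_apply`, `cofreeTorsionLocalInclusion_cofreeTorsionLocalScalar`.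

References: [Greenberg1989] §1 p. 98; [Kato2004Asterisque] §13.8 (p. 228).
-/

set_option autoImplicit false
-- the Theorems namespace of this sub repeats the summit name by design (D-0017 nested layout)
set_option linter.dupNamespace false

noncomputable section

open scoped Classical

namespace Summit.BirchSwinnertonDyer.BirchSwinnertonDyer.Theorems.ThetaTransport

open CategoryTheory Field NumberField IsDedekindDomain
  Literature.NumberTheory.EllipticCurves Literature.NumberTheory.GaloisRepresentations
  Literature.NumberTheory.EllipticCurves.GreenbergSelmer Literature.NumberTheory.EllipticCurves.CyclotomicLayer
  Literature.NumberTheory.GaloisRepresentations.DiscreteGaloisModule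

variable {p : ℕ} [Fact p.Prime] (S : Set (PadicAlgCl p)) {d : ℕ} (ρ : FramedGaloisRep ℚ ↥(padicCoeffIntegers S) d) (N : ℤ)
  (a : ↥(padicCoeffIntegers S))

/-! ## §1 `a · : A_ρ[N] ⟶ A_ρ[N]` -/

/-- `a • x ∈ A_ρ[N]` for `x ∈ A_ρ[N]` (`N (a x) = a (N x) = 0`). [cite: Greenberg1989, §1 p. 98] -/
theorem smul_coe_mem_cofreeTorsionBy (x : ↥(AddSubgroup.torsionBy (Cofree ρ ↥(padicCoeffField S)) N)) :
    a • (x : Cofree ρ ↥(padicCoeffField S)) ∈ AddSubgroup.torsionBy (Cofree ρ ↥(padicCoeffField S)) N := by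
  refine (Submodule.mem_torsionBy_iff (R := ℤ) _ _).mpr ?_
  rw [smul_comm, (Submodule.mem_torsionBy_iff (R := ℤ) _ _).mp x.2, smul_zero]

/-- **`a · : A_ρ[N] ⟶ A_ρ[N]`** (`x ↦ a • x`), a morphism of the discrete `Γ_ℚ`-modules (`Γ_ℚ` acts `𝒪`-linearly on `A_ρ`). [cite: Greenberg1989, §1 p. 98] -/
def cofreeTorsionScalar :
    (cofreeTorsionGaloisModule S ρ N).toTopRep ⟶ (cofreeTorsionGaloisModule S ρ N).toTopRep :=
  TopRep.ofHom
    { toContinuousLinearMap :=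
        { toFun := fun x ↦ ⟨a • (x : Cofree ρ ↥(padicCoeffField S)), smul_coe_mem_cofreeTorsionBy S ρ N a x⟩
          map_add' := fun x y ↦ Subtype.ext (by
            change a • ((x : Cofree ρ ↥(padicCoeffField S)) + (y : Cofree ρ ↥(padicCoeffField S))) =
              a • (x : Cofree ρ ↥(padicCoeffField S)) + a • (y : Cofree ρ ↥(padicCoeffField S))
            rw [smul_add])
          map_smul' := fun c x ↦ Subtype.ext (by
            change a • (c • (x : Cofree ρ ↥(padicCoeffField S))) = c • (a • (x : Cofree ρ ↥(padicCoeffField S)))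
            rw [smul_comm])
          cont := continuous_of_discreteTopology }
      isIntertwining' := fun σ ↦ by
        ext x
        change a • ((cofreeTorsionGaloisModule S ρ _ σ x : ↥(AddSubgroup.torsionBy _ _)) : Cofree ρ ↥(padicCoeffField S)) =
          σ • (a • (x : Cofree ρ ↥(padicCoeffField S)))
        rw [cofreeTorsionGaloisModule_apply_apply, Literature.NumberTheory.EllipticCurves.AddSubgroup.torsionBy.coe_smul]
        exact (smul_comm σ a (x : Cofree ρ ↥(padicCoeffField S))).symm }

/-- Values of `cofreeTorsionScalar`: `x ↦ a • x` (definitional). [cite: Greenberg1989, §1 p. 98] -/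
@[simp] theorem coe_cofreeTorsionScalar_apply (x : ↥(AddSubgroup.torsionBy (Cofree ρ ↥(padicCoeffField S)) N)) :
    (((cofreeTorsionScalar S ρ N a).hom x : ↥(AddSubgroup.torsionBy (Cofree ρ ↥(padicCoeffField S)) N)) : Cofree ρ ↥(padicCoeffField S)) =
      a • (x : Cofree ρ ↥(padicCoeffField S)) := rfl

/-- `(A_ρ[N] ↪ A_ρ) ∘ (a ·) = (a ·) ∘ (A_ρ[N] ↪ A_ρ)` (`cofreeScalar`). [cite: Greenberg1989, §1 p. 98] -/
theorem cofreeTorsionInclusion_cofreeTorsionScalar (x : ↥(AddSubgroup.torsionBy (Cofree ρ ↥(padicCoeffField S)) N)) :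
    (cofreeTorsionInclusion S ρ N).hom ((cofreeTorsionScalar S ρ N a).hom x) = (cofreeScalar S ρ a).hom ((cofreeTorsionInclusion S ρ N).hom x) := rfl

/-- **`a · (p^{-k} t) = p^{-k} (a t)`**: on `T_ρ/p^k ≅ A_ρ[p^k]` the scalar endomorphism is multiplication by `a` on coordinates (`cofreeMk` is `𝒪`-linear).
[cite: Kato2004Asterisque, §13.8 (p. 228)] -/
theorem cofreeTorsionScalar_divPowCofreeMkTorsion (k : ℕ) (t : Fin d → ↥(padicCoeffIntegers S)) :
    (cofreeTorsionScalar S ρ ((p ^ k : ℕ) : ℤ) a).hom (divPowCofreeMkTorsion S ρ k t) = divPowCofreeMkTorsion S ρ k (a • t) := by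
  refine Subtype.ext ?_
  rw [coe_cofreeTorsionScalar_apply, coe_divPowCofreeMkTorsion_apply, coe_divPowCofreeMkTorsion_apply, divPowCofreeMk_apply, divPowCofreeMk_apply,
    ← map_smul]
  congr 1
  funext i
  simp only [Pi.smul_apply]
  simp only [smul_eq_mul, map_mul, Algebra.smul_def]
  ring

variable (v : HeightOneSpectrum (𝓞 ℚ))

/-! ## §2 The local form `a · : A_ρ[N]|_{Γ_v} ⟶ A_ρ[N]|_{Γ_v}` -/

/-- **`a ·` on the local coefficient module `A_ρ[N]|_{Γ_v}`.** [cite: Greenberg1989, §1 p. 98] -/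
def cofreeTorsionLocalScalar : cofreeTorsionLocalRep S ρ N v ⟶ cofreeTorsionLocalRep S ρ N v :=
  TopRep.ofHom ((cofreeTorsionScalar S ρ N a).hom.restrictField (v.adicCompletion ℚ))

/-- Values of `cofreeTorsionLocalScalar` in the torsion subgroup: the same as `cofreeTorsionScalar`. [cite: Greenberg1989, §1 p. 98] -/
theorem cofreeTorsionLocalScalar_apply (x : ↥(AddSubgroup.torsionBy (Cofree ρ ↥(padicCoeffField S)) N)) :
    (cofreeTorsionLocalScalar S ρ N a v).hom x = (cofreeTorsionScalar S ρ N a).hom x := rfl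

/-- Values of `cofreeTorsionLocalScalar`: `x ↦ a • x`. [cite: Greenberg1989, §1 p. 98] -/
@[simp] theorem coe_cofreeTorsionLocalScalar_apply (x : ↥(AddSubgroup.torsionBy (Cofree ρ ↥(padicCoeffField S)) N)) :
    (((cofreeTorsionLocalScalar S ρ N a v).hom x : ↥(AddSubgroup.torsionBy (Cofree ρ ↥(padicCoeffField S)) N)) : Cofree ρ ↥(padicCoeffField S)) =
      a • (x : Cofree ρ ↥(padicCoeffField S)) := rfl

/-- `(A_ρ[N]| ↪ A_ρ|) ∘ (a ·) = (a ·) ∘ (A_ρ[N]| ↪ A_ρ|)` locally (`cofreeLocalScalar`). [cite: Greenberg1989, §1 p. 98] -/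
theorem cofreeTorsionLocalInclusion_cofreeTorsionLocalScalar (x : ↥(AddSubgroup.torsionBy (Cofree ρ ↥(padicCoeffField S)) N)) :
    (cofreeTorsionLocalInclusion S ρ N v).hom ((cofreeTorsionLocalScalar S ρ N a v).hom x) =
      (cofreeLocalScalar S ρ a v).hom ((cofreeTorsionLocalInclusion S ρ N v).hom x) := rfl

end Summit.BirchSwinnertonDyer.BirchSwinnertonDyer.Theorems.ThetaTransport

end
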